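import Mathlib
import Summits.ResolutionOfSingularities.ResolutionOfSingularities.Theorems.HomologicalConductorPersistenceVeroneseDefs
import HarnessLib

/-!
# The graded pieces `M₁[u]`, `M₂[u]` of `k[a,b,u]` over the Veronese cylinder, I: the pieces and `Ω M₁ = M₂`

Crux `HomologicalConductor.Persistence` (stmt-ResolutionOfSingularities-16484), chain W4.4b, rung L1; helper for
T-HOLD = `PersistenceVeroneseDefs.CubicsLevelFive` (bricks B2/B3 of res-L1-w44b-stub-3's THOLD-MECHANISM memo,
evidence #55 on the crux item: the standard covers and syzygies of the Veronese pieces are the input of its §4).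
`[OURS · L1 w44b]` — elementary commutative algebra of ONE stage of the route's `ca`-tower; NOT a statement of
the manuscript under review, and no statement of that manuscript is used; AI-written (weaker than expert review).

`R := veroneseCylinder k = k[a³, a²b, ab², b³, u] ⊆ P := k[a,b,u]` (`a = X 0`, `b = X 1`, `u = X 2`) is the
weighted-degree-`0` part for `veroneseWeight = (1,1,0) mod 3` (`mem_veroneseCylinder_iff`); `P = R ⊕ P₁ ⊕ P₂` as an
`R`-module, `P_g` = polynomials of weight `g` (`P₁ = M₁[u] = Ra + Rb`, `P₂ = M₂[u] = Ra² + Rab + Rb²`). This file: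

* `piece k g` — the `R`-submodule of `P` of weight-`g` polynomials (`mem_piece_iff`); `pieceZeroEquiv : P₀ ≃ R`;
  `mulHom g h q _ : P_g → P_h` — multiplication by a homogeneous `q` of weight `h - g`;
* `cover₁ : R² → P₁`, `(r,s) ↦ ra + sb`, onto (`cover₁_surjective`); `syz₁ : P₂ → R²`, `t ↦ (tb, -ta)`, injective
  (`syz₁_injective`), and `exact_syz₁_cover₁` : `0 → P₂ → R² → P₁ → 0` is exact — «`Ω M₁ = M₂`», in EVERY
  characteristic (including `3`: the Veronese is toric, no group action is used);
* divisibility helpers in `k[σ]`: `isWeightedHomogeneous_of_X_mul`, `eq_X_mul_divMonomial`,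
  `isWeightedHomogeneous_divMonomial`, `isWeightedHomogeneous_modMonomial` (Mathlib's `divMonomial`/`modMonomial`
  and `MvPolynomial.X_dvd_mul_iff`).

Part II (`…PersistenceVeroneseSyzygyTwo.lean`): `0 → P₂² → R³ → P₂ → 0` and `Ω(a·) = (1,0)ᵀ`, `Ω(b·) = (0,1)ᵀ`.
-/

-- single-problem summit: the doubled namespace component is forced
set_option linter.dupNamespace false
-- `Module ↥(veroneseCylinder k) ↥(piece k g)` (a submodule over a subalgebra used as base ring) is found by
-- instance search, but slowly (≈ 4× the default budget); nothing else is affected.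
set_option synthInstance.maxHeartbeats 100000

noncomputable section

universe u

namespace Summit.ResolutionOfSingularities.ResolutionOfSingularities.Theorems.HomologicalConductor.PersistenceVeronesePieces

open MvPolynomial
open Summit.ResolutionOfSingularities.ResolutionOfSingularities.Theorems.HomologicalConductor.PersistenceVeroneseDefs
open Summit.ResolutionOfSingularities.ResolutionOfSingularities.Theorems.HomologicalConductor.PersistenceVeroneseExponentTwo
  (isWeightedHomogeneous_of_eq)

variable (k : Type u) [Field k]

/-! ## Weights and divisibility in `k[σ]` -/

/-- The weight of an exponent vector `d` for `veroneseWeight` is `d 0 + d 1 (mod 3)`. [OURS · L1 w44b] -/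
theorem weight_eq (d : Fin 3 →₀ ℕ) :
    Finsupp.weight veroneseWeight d = ((d 0 + d 1 : ℕ) : ZMod 3) := by
  rw [Finsupp.weight_apply, Finsupp.sum_fintype d (fun i c => c • veroneseWeight i)
    (fun i => zero_smul ℕ (veroneseWeight i)), Fin.sum_univ_three]
  simp [veroneseWeight, nsmul_eq_mul]

/-- `a = X 0` has weight `1`. [OURS · L1 w44b] -/
theorem isWeightedHomogeneous_a : IsWeightedHomogeneous veroneseWeight (X 0 : MvPolynomial (Fin 3) k) 1 :=
  isWeightedHomogeneous_X k veroneseWeight 0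

/-- `b = X 1` has weight `1`. [OURS · L1 w44b] -/
theorem isWeightedHomogeneous_b : IsWeightedHomogeneous veroneseWeight (X 1 : MvPolynomial (Fin 3) k) 1 :=
  isWeightedHomogeneous_X k veroneseWeight 1

/-- If `X i * q` is weighted homogeneous of weight `m`, then `q` is weighted homogeneous of weight
`m - w i`. [folklore] -/
theorem isWeightedHomogeneous_of_X_mul {σ M : Type*} [AddCommGroup M] (w : σ → M) (i : σ)
    {q : MvPolynomial σ k} {m : M} (h : IsWeightedHomogeneous w (X i * q) m) :
    IsWeightedHomogeneous w q (m - w i) := by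
  classical
  intro d hd
  have h1 : coeff (Finsupp.single i 1 + d) (X i * q) ≠ 0 := by
    rwa [coeff_X_mul]
  have h2 := h h1
  rw [map_add, Finsupp.weight_single, one_smul] at h2
  exact eq_sub_of_add_eq' h2

/-- If every monomial of `p` is divisible by `X i`, then `p = X i * (p /ᵐᵒⁿᵒᵐⁱᵃˡ single i 1)`. [folklore] -/
theorem eq_X_mul_divMonomial {σ : Type*} (i : σ) (p : MvPolynomial σ k)
    (h : ∀ d ∈ p.support, 1 ≤ d i) : p = X i * p.divMonomial (Finsupp.single i 1) := by
  classical
  have hmod : p.modMonomial (Finsupp.single i 1) = 0 := by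
    ext d
    by_cases hd : Finsupp.single i 1 ≤ d
    · rw [coeff_modMonomial_of_le _ hd, coeff_zero]
    · rw [coeff_modMonomial_of_not_le _ hd, coeff_zero]
      by_contra hne
      exact hd (Finsupp.single_le_iff.mpr (h d (mem_support_iff.mpr hne)))
  have := divMonomial_add_modMonomial_single p i
  rw [hmod, add_zero] at this
  exact this.symm

/-- The quotient `p /ᵐᵒⁿᵒᵐⁱᵃˡ single i 1` of a weight-`m` polynomial has weight `m - w i`. [folklore] -/
theorem isWeightedHomogeneous_divMonomial {σ M : Type*} [AddCommGroup M] (w : σ → M) (i : σ)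
    {p : MvPolynomial σ k} {m : M} (hp : IsWeightedHomogeneous w p m) :
    IsWeightedHomogeneous w (p.divMonomial (Finsupp.single i 1)) (m - w i) := by
  classical
  intro d hd
  rw [coeff_divMonomial] at hd
  have := hp hd
  rw [map_add, Finsupp.weight_single, one_smul] at this
  exact eq_sub_of_add_eq' this

/-- The remainder `p %ᵐᵒⁿᵒᵐⁱᵃˡ single i 1` of a weight-`m` polynomial has weight `m`. [folklore] -/
theorem isWeightedHomogeneous_modMonomial {σ M : Type*} [AddCommMonoid M] (w : σ → M) (i : σ)
    {p : MvPolynomial σ k} {m : M} (hp : IsWeightedHomogeneous w p m) :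
    IsWeightedHomogeneous w (p.modMonomial (Finsupp.single i 1)) m := by
  classical
  intro d hd
  by_cases h : Finsupp.single i 1 ≤ d
  · rw [coeff_modMonomial_of_le _ h] at hd
    exact absurd rfl hd
  · rw [coeff_modMonomial_of_not_le _ h] at hd
    exact hp hd

/-- The remainder `p %ᵐᵒⁿᵒᵐⁱᵃˡ single i 1` has no monomial divisible by `X i`. [folklore] -/
theorem apply_eq_zero_of_mem_support_modMonomial {σ : Type*} (i : σ) (p : MvPolynomial σ k)
    (d : σ →₀ ℕ) (hd : d ∈ (p.modMonomial (Finsupp.single i 1)).support) : d i = 0 := by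
  classical
  by_contra hne
  have hle : Finsupp.single i 1 ≤ d := Finsupp.single_le_iff.mpr (Nat.one_le_iff_ne_zero.mpr hne)
  exact (mem_support_iff.mp hd) (coeff_modMonomial_of_le _ hle)

/-- A polynomial of `k[a,b,u]` of NON-ZERO weight without monomials divisible by `a` has all its monomials
divisible by `b`. [OURS · L1 w44b] -/
theorem one_le_apply_one_of_weight {p : MvPolynomial (Fin 3) k} {g : ZMod 3}
    (hp : IsWeightedHomogeneous veroneseWeight p g) (hg : g ≠ 0)
    (h0 : ∀ d ∈ p.support, d 0 = 0) (d : Fin 3 →₀ ℕ) (hd : d ∈ p.support) : 1 ≤ d 1 := by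
  have hw : Finsupp.weight veroneseWeight d = g := hp (mem_support_iff.mp hd)
  rw [weight_eq, h0 d hd, zero_add] at hw
  by_contra hlt
  have h1 : d 1 = 0 := by omega
  rw [h1] at hw
  exact hg (by simpa using hw.symm)

/-! ## The pieces -/

/-- [OURS · L1 w44b] The weight-`g` piece `P_g ⊆ k[a,b,u]` as a module over the Veronese cylinder
`R = veroneseCylinder k` (the weight-`0` subalgebra): `P₀ = R`, `P₁ = M₁[u] = Ra + Rb`,
`P₂ = M₂[u] = Ra² + Rab + Rb²` (`R`-submodules of `P`, since weights add). NOT a statement of the manuscript. -/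
def piece (g : ZMod 3) : Submodule (veroneseCylinder k) (MvPolynomial (Fin 3) k) where
  carrier := {p | IsWeightedHomogeneous veroneseWeight p g}
  add_mem' := fun hp hq => hp.add hq
  zero_mem' := isWeightedHomogeneous_zero k veroneseWeight g
  smul_mem' := fun r p hp => by
    have hr : IsWeightedHomogeneous veroneseWeight (r : MvPolynomial (Fin 3) k) 0 :=
      (mem_veroneseCylinder_iff k r).mp r.2
    change IsWeightedHomogeneous veroneseWeight ((r : MvPolynomial (Fin 3) k) * p) g
    simpa using hr.mul hp

/-- Membership in `piece k g` is weighted homogeneity of weight `g`. [OURS · L1 w44b] -/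
theorem mem_piece_iff {g : ZMod 3} {p : MvPolynomial (Fin 3) k} :
    p ∈ piece k g ↔ IsWeightedHomogeneous veroneseWeight p g := Iff.rfl

/-- `piece k 0` has the same elements as the Veronese cylinder. [OURS · L1 w44b] -/
theorem mem_piece_zero_iff {p : MvPolynomial (Fin 3) k} : p ∈ piece k 0 ↔ p ∈ veroneseCylinder k := by
  rw [mem_piece_iff, mem_veroneseCylinder_iff]

/-- Products: `P_g · P_h ⊆ P_{g+h}`. [OURS · L1 w44b] -/
theorem mul_mem_piece {g h : ZMod 3} {p q : MvPolynomial (Fin 3) k} (hp : p ∈ piece k g)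
    (hq : q ∈ piece k h) : p * q ∈ piece k (g + h) :=
  IsWeightedHomogeneous.mul hp hq

/-- [OURS · L1 w44b] `P₀ ≅ R` as `R`-modules (the identity on underlying polynomials). -/
def pieceZeroEquiv : piece k 0 ≃ₗ[veroneseCylinder k] veroneseCylinder k where
  toFun p := ⟨p, (mem_piece_zero_iff k).mp p.2⟩
  invFun r := ⟨r, (mem_piece_zero_iff k).mpr r.2⟩
  map_add' _ _ := rfl
  map_smul' _ _ := rfl
  left_inv _ := rfl
  right_inv _ := rfl

/-- Underlying polynomial of `pieceZeroEquiv p`. [OURS · L1 w44b] -/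
theorem coe_pieceZeroEquiv (p : piece k 0) :
    ((pieceZeroEquiv k p : veroneseCylinder k) : MvPolynomial (Fin 3) k) = p := rfl

/-- [OURS · L1 w44b] Multiplication by a homogeneous polynomial `q` of weight `h - g` as an `R`-linear map
`P_g → P_h` (e.g. `a· : P₁ → P₂`, `a· : P₂ → P₀`). -/
def mulHom (g h : ZMod 3) (q : MvPolynomial (Fin 3) k) (hq : IsWeightedHomogeneous veroneseWeight q (h - g)) :
    piece k g →ₗ[veroneseCylinder k] piece k h where
  toFun p := ⟨(p : MvPolynomial (Fin 3) k) * q, by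
    have := mul_mem_piece k p.2 hq
    rwa [add_sub_cancel] at this⟩
  map_add' p p' := by
    ext
    simp [add_mul]
  map_smul' r p := by
    ext
    simp [Subalgebra.smul_def, smul_eq_mul, mul_assoc]

/-- Underlying polynomial of `mulHom … p`. [OURS · L1 w44b] -/
theorem coe_mulHom {g h : ZMod 3} (q : MvPolynomial (Fin 3) k)
    (hq : IsWeightedHomogeneous veroneseWeight q (h - g)) (p : piece k g) :
    ((mulHom k g h q hq p : piece k h) : MvPolynomial (Fin 3) k) = (p : MvPolynomial (Fin 3) k) * q := rfl

/-- `b` as a map `P₂ → P₀`: weight bookkeeping `1 = 0 - 2`. [OURS · L1 w44b] -/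
theorem isWeightedHomogeneous_b' :
    IsWeightedHomogeneous veroneseWeight (X 1 : MvPolynomial (Fin 3) k) ((0 : ZMod 3) - 2) :=
  isWeightedHomogeneous_of_eq k veroneseWeight (isWeightedHomogeneous_b k) (by decide)

/-- `a` as a map `P₂ → P₀`: weight bookkeeping `1 = 0 - 2`. [OURS · L1 w44b] -/
theorem isWeightedHomogeneous_a' :
    IsWeightedHomogeneous veroneseWeight (X 0 : MvPolynomial (Fin 3) k) ((0 : ZMod 3) - 2) :=
  isWeightedHomogeneous_of_eq k veroneseWeight (isWeightedHomogeneous_a k) (by decide)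

/-- [OURS · L1 w44b] Multiplication by `b`, `P₂ → P₀ ≅ R`. -/
def mulB : piece k 2 →ₗ[veroneseCylinder k] veroneseCylinder k :=
  (pieceZeroEquiv k).toLinearMap ∘ₗ mulHom k 2 0 (X 1) (isWeightedHomogeneous_b' k)

/-- [OURS · L1 w44b] Multiplication by `a`, `P₂ → P₀ ≅ R`. -/
def mulA : piece k 2 →ₗ[veroneseCylinder k] veroneseCylinder k :=
  (pieceZeroEquiv k).toLinearMap ∘ₗ mulHom k 2 0 (X 0) (isWeightedHomogeneous_a' k)

/-- Underlying polynomial of `mulB t`. [OURS · L1 w44b] -/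
theorem coe_mulB (t : piece k 2) :
    ((mulB k t : veroneseCylinder k) : MvPolynomial (Fin 3) k) = (t : MvPolynomial (Fin 3) k) * X 1 := rfl

/-- Underlying polynomial of `mulA t`. [OURS · L1 w44b] -/
theorem coe_mulA (t : piece k 2) :
    ((mulA k t : veroneseCylinder k) : MvPolynomial (Fin 3) k) = (t : MvPolynomial (Fin 3) k) * X 0 := rfl

/-! ## The cover `R² → P₁` and its kernel `P₂` («`Ω M₁ = M₂`») -/

/-- The generators `a, b` of `P₁`. [OURS · L1 w44b] -/
def gen₁ : Fin 2 → piece k 1 :=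
  ![⟨X 0, isWeightedHomogeneous_a k⟩, ⟨X 1, isWeightedHomogeneous_b k⟩]

/-- [OURS · L1 w44b] The standard cover `R² → P₁`, `(r, s) ↦ r a + s b`. -/
def cover₁ : (Fin 2 → veroneseCylinder k) →ₗ[veroneseCylinder k] piece k 1 :=
  Fintype.linearCombination (veroneseCylinder k) (gen₁ k)

/-- Underlying polynomial of `cover₁ v`. [OURS · L1 w44b] -/
theorem coe_cover₁ (v : Fin 2 → veroneseCylinder k) :
    ((cover₁ k v : piece k 1) : MvPolynomial (Fin 3) k) =
      (v 0 : MvPolynomial (Fin 3) k) * X 0 + (v 1 : MvPolynomial (Fin 3) k) * X 1 := by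
  simp [cover₁, Fintype.linearCombination_apply, Fin.sum_univ_two, gen₁, Subalgebra.smul_def, smul_eq_mul]

/-- [OURS · L1 w44b] The syzygy map `P₂ → R²`, `t ↦ (t b, -t a)`. -/
def syz₁ : piece k 2 →ₗ[veroneseCylinder k] (Fin 2 → veroneseCylinder k) :=
  LinearMap.pi ![mulB k, -mulA k]

/-- First component of `syz₁ t` is `t b`. [OURS · L1 w44b] -/
theorem coe_syz₁_zero (t : piece k 2) :
    ((syz₁ k t 0 : veroneseCylinder k) : MvPolynomial (Fin 3) k) = (t : MvPolynomial (Fin 3) k) * X 1 := rfl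

/-- Second component of `syz₁ t` is `-t a`. [OURS · L1 w44b] -/
theorem coe_syz₁_one (t : piece k 2) :
    ((syz₁ k t 1 : veroneseCylinder k) : MvPolynomial (Fin 3) k) = -((t : MvPolynomial (Fin 3) k) * X 0) := rfl

/-- `syz₁` is injective (`k[a,b,u]` is a domain). [OURS · L1 w44b] -/
theorem syz₁_injective : Function.Injective (syz₁ k) := by
  intro t t' h
  have h0 := congrArg (fun v => ((v 0 : veroneseCylinder k) : MvPolynomial (Fin 3) k)) h
  simp only [coe_syz₁_zero] at h0
  exact Subtype.ext (mul_right_cancel₀ (X_ne_zero 1) h0)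

/-- `cover₁ ∘ syz₁ = 0` (`tb·a - ta·b = 0`). [OURS · L1 w44b] -/
theorem cover₁_syz₁ (t : piece k 2) : cover₁ k (syz₁ k t) = 0 := by
  apply Subtype.ext
  rw [coe_cover₁, coe_syz₁_zero, coe_syz₁_one]
  change _ = (0 : MvPolynomial (Fin 3) k)
  ring

/-- **`0 → P₂ → R² → P₁` is exact**: the kernel of `(r,s) ↦ ra + sb` is `{(tb, -ta) : t ∈ P₂}` — the
syzygy module of `M₁` is `M₂` (every characteristic). [OURS · L1 w44b] -/
theorem exact_syz₁_cover₁ : Function.Exact (syz₁ k) (cover₁ k) := by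
  intro v
  constructor
  · intro hv
    have h0 : (v 0 : MvPolynomial (Fin 3) k) * X 0 + (v 1 : MvPolynomial (Fin 3) k) * X 1 = 0 := by
      rw [← coe_cover₁, hv]
      rfl
    -- `X 0 ∣ v 1`
    have hdvd : (X 0 : MvPolynomial (Fin 3) k) ∣ (v 1 : MvPolynomial (Fin 3) k) * X 1 :=
      ⟨-(v 0 : MvPolynomial (Fin 3) k), by linear_combination h0⟩
    rcases MvPolynomial.X_dvd_mul_iff.mp hdvd with ⟨t, ht⟩ | habs
    · -- `v 1 = X 0 * t`, hence `v 0 = -t * X 1`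
      have hv0 : (v 0 : MvPolynomial (Fin 3) k) = -(t * X 1) := by
        have h1 : (X 0 : MvPolynomial (Fin 3) k) * ((v 0 : MvPolynomial (Fin 3) k) + t * X 1) = 0 := by
          linear_combination h0 - X 1 * ht
        rcases mul_eq_zero.mp h1 with h | h
        · exact absurd h (X_ne_zero 0)
        · linear_combination h
      have ht2 : IsWeightedHomogeneous veroneseWeight t 2 := by
        have h1 : IsWeightedHomogeneous veroneseWeight (v 1 : MvPolynomial (Fin 3) k) 0 :=
          (mem_veroneseCylinder_iff k _).mp (v 1).2
        rw [ht] at h1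
        exact isWeightedHomogeneous_of_eq k veroneseWeight (isWeightedHomogeneous_of_X_mul k veroneseWeight 0 h1)
          (by decide)
      refine ⟨⟨-t, (piece k 2).neg_mem ht2⟩, funext (Fin.forall_fin_two.mpr ⟨?_, ?_⟩)⟩
      · apply Subtype.ext
        rw [coe_syz₁_zero, hv0]
        change (-t) * X 1 = _
        ring
      · apply Subtype.ext
        rw [coe_syz₁_one, ht]
        change -((-t) * X 0) = _
        ring
    · exact absurd (MvPolynomial.X_dvd_X.mp habs) (by decide)
  · rintro ⟨t, rfl⟩
    exact cover₁_syz₁ k t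

/-- **`cover₁` is onto**: every weight-`1` polynomial is `r a + s b` with `r, s` of weight `0`
(`r = p /ᵐᵒⁿᵒᵐⁱᵃˡ a`, `s = (p %ᵐᵒⁿᵒᵐⁱᵃˡ a) /ᵐᵒⁿᵒᵐⁱᵃˡ b`). [OURS · L1 w44b] -/
theorem cover₁_surjective : Function.Surjective (cover₁ k) := by
  classical
  rintro ⟨p, hp⟩
  set q := p.divMonomial (Finsupp.single 0 1) with hq
  set p₀ := p.modMonomial (Finsupp.single 0 1) with hp₀
  have hsplit : X 0 * q + p₀ = p := divMonomial_add_modMonomial_single p 0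
  have hqw : IsWeightedHomogeneous veroneseWeight q 0 :=
    isWeightedHomogeneous_of_eq k veroneseWeight (isWeightedHomogeneous_divMonomial k veroneseWeight 0 hp)
      (by decide)
  have hp₀w : IsWeightedHomogeneous veroneseWeight p₀ 1 := isWeightedHomogeneous_modMonomial k veroneseWeight 0 hp
  have hp₀b : p₀ = X 1 * p₀.divMonomial (Finsupp.single 1 1) :=
    eq_X_mul_divMonomial k 1 p₀ (one_le_apply_one_of_weight k hp₀w one_ne_zero
      (apply_eq_zero_of_mem_support_modMonomial k 0 p))
  set s := p₀.divMonomial (Finsupp.single 1 1) with hs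
  have hsw : IsWeightedHomogeneous veroneseWeight s 0 :=
    isWeightedHomogeneous_of_eq k veroneseWeight (isWeightedHomogeneous_divMonomial k veroneseWeight 1 hp₀w)
      (by decide)
  refine ⟨![⟨q, (mem_veroneseCylinder_iff k q).mpr hqw⟩, ⟨s, (mem_veroneseCylinder_iff k s).mpr hsw⟩], ?_⟩
  apply Subtype.ext
  rw [coe_cover₁]
  change q * X 0 + s * X 1 = p
  rw [← hsplit, hp₀b]
  ring

end Summit.ResolutionOfSingularities.ResolutionOfSingularities.Theorems.HomologicalConductor.PersistenceVeronesePieces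

end
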